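import Literature.NumberTheory.Automorphic.CDTTheorem722
import Literature.NumberTheory.Automorphic.CDTTheorem722Proofs
import Literature.NumberTheory.Automorphic.CDTTheorem722ThreeFactsProofs
import Literature.NumberTheory.Automorphic.CDTTheorem712
import Literature.NumberTheory.Automorphic.BCDTModularityModPProofs
import Literature.NumberTheory.EllipticCurves.CuspFormLFunctionLevelConductorProofs
import Literature.NumberTheory.EllipticCurves.CuspFormLFunctionLevelConductorOfCarayolProofs
import Literature.NumberTheory.EllipticCurves.EisensteinNewformLevelRaising
import Literature.NumberTheory.EllipticCurves.NewformGaloisRepEulerFactors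
import Literature.NumberTheory.EllipticCurves.Szpiro
import HarnessLib

/-!
# Stub ideation k = 2, generation 3, for `stub_threeImpTwo` (S9) of crux `FreyModularity`
# (stmt-ABC-11340, route-ABC-DefiniteXi) — helper-lemma SIGNATURES, companion of
# `STUB-IDEAS-stub_threeImpTwo-2.md` (gen 3).  Elaboration sanity only: helper bodies are `sorry`;
# every glue / composition theorem is a real (kernel-checked) proof.

RESHAPE (family 2), gen-3 delta over `STUB_IDEAS_stub_threeImpTwo_2g2_Sketch.lean` (gen 2, kept for
T1 = the level regime split E/F/G):

* T-A (split-by-consumer + change of variable `ℓ ↦ p'`): the torsion-level cut `h32T` is re-based from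
  Deligne's `Hida2000_thm326_exists_galoisRep` (`hD`) onto ideator-1's weakest leaf
  `L_A = RatNewformGaloisRepCofinal` (copied verbatim below; `L_A ⇐ hD` and `L_A ⇐ ES_w ⇐ hES` are
  PROVED in `STUB_IDEAS_stub_threeImpTwo_1_Sketch.lean`), through a BINDER-form hole closer (H2) that
  consumes ONE attached irreducible `ρ_g` at ONE auxiliary prime — the output of ideator-1's PROVED
  `H2'_equiv_of_isGaloisRepOfNewform1`;
* the RECUT COMPOSITION `isModular_freyCurve_of_recut` — kernel-checked: the skeleton's
  `isModular_freyCurve_of_stubs` with S9 consumed only through its two WEAKER cuts `h32F` (Frey curve,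
  level `N_E`) and `h32T` (switched curve, torsion level), i.e. the exact re-glue a lead can register.
-/

noncomputable section

open scoped NumberField Polynomial MatrixGroups ModularForm
open NumberField IsDedekindDomain IsDedekindDomain.HeightOneSpectrum Polynomial
open CongruenceSubgroup Rat.HeightOneSpectrum
open Literature.NumberTheory.EllipticCurves
open Literature.NumberTheory.EllipticCurves.ModularForms
open Literature.NumberTheory.Automorphic
open Literature.NumberTheory.Automorphic.BCDT
open Literature.NumberTheory.GaloisRepresentations
open WeierstrassCurve

attribute [local instance] AddSubgroup.torsionBy.zmodModule

namespace Summit.ABC.ABC.Cruxes.FreyModularity.Sketch.StubIdeasThreeImpTwo2G3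

/-! ## The stub and its two cuts -/

/-- The registered stub S9, verbatim. -/
def SigStubThreeImpTwo : Prop :=
  ∀ (W : WeierstrassCurve ℚ) [W.IsElliptic] [NeZero (W.conductorNorm ℤ)] (ℓ : ℕ) [Fact ℓ.Prime],
    W.IsModularGaloisRepTate ℓ → BCDT.IsModular W

/-- `h32F` — S9 restricted to Frey curves (consumers I1, I3 of `isModular_freyCurve_of_stubs`). -/
def SigThreeImpTwoFrey : Prop :=
  ∀ (a b : ℤ), IsCoprime a b → a * b * (a + b) ≠ 0 →
    ∀ [(freyCurve a b).IsElliptic] [NeZero ((freyCurve a b).conductorNorm ℤ)] (ℓ : ℕ) [Fact ℓ.Prime],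
      (freyCurve a b).IsModularGaloisRepTate ℓ → BCDT.IsModular (freyCurve a b)

/-- `h32T` — S9 at TORSION level for the switched curve `W'` (consumer I2): `ρ_{W',3}` modular ⇒
every framed model of `W'[5]` is modular (the lead's S10, NOTES c41). -/
def SigThreeImpTwoTorsion : Prop :=
  ∀ (W : WeierstrassCurve ℚ) [W.IsElliptic], W.IsModularGaloisRepTate 3 →
    ∀ (ρ : ModPGaloisRep ℚ (ZMod 5) 2), W.IsTorsionGaloisRep 5 ρ → ρ.IsModular

/-- **Leaf `L_A`** (ideator-1, gen 2; copied VERBATIM so that this file is self-contained): every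
rational newform `f₀ ∈ S₂(Γ₀(N))` has, for cofinally many primes `p`, an irreducible `ρ : Γ_ℚ → GL₂(ℚ̄_p)`
attached to `liftToGamma1 N 2 f₀` off `N p`.  Specialisation of the catalogued
`Hida2000_thm326_exists_galoisRep`; also implied by (weak) Eichler–Shimura. -/
def RatNewformGaloisRepCofinal : Prop :=
  ∀ {N : ℕ} [NeZero N] (f₀ : CuspForm (Gamma0 N) 2), IsNewform0 f₀ →
    (∀ n : ℕ, ∃ z : ℤ, cuspCoeff f₀ n = z) → ∀ B : ℕ,
    ∃ (p : ℕ) (_ : Fact p.Prime), B < p ∧ ∀ ι : PadicAlgCl p ≃+* ℂ,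
      ∃ ρ : FramedGaloisRep ℚ (PadicAlgCl p) 2,
        IsGaloisRepOfNewform1 (liftToGamma1 N 2 f₀)
          ((ι.symm : ℂ →+* PadicAlgCl p).comp (algebraMap (coeffCharField (liftToGamma1 N 2 f₀)) ℂ))
          {q | q ∣ N * p} ρ ∧
        ρ.toGaloisRep.IsIrreducible

/-- `hD ⇒ L_A` (ideator-1's `ratNewformGaloisRepCofinal_of_hida`, proof repeated: 6 lines). -/
theorem ratNewformGaloisRepCofinal_of_hida (hD : Hida2000_thm326_exists_galoisRep) :
    RatNewformGaloisRepCofinal := by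
  intro N _ f₀ hf₀ _ B
  obtain ⟨p, hBp, hp⟩ := Nat.exists_infinite_primes (B + 1)
  haveI : Fact p.Prime := ⟨hp⟩
  refine ⟨p, ⟨hp⟩, by omega, fun ι ↦ ?_⟩
  exact hD (liftToGamma1 N 2 f₀) le_rfl
    ((isNewform1_liftToGamma1_iff_holds (N := N) (k := 2) f₀).mpr hf₀) p ι

/-! ## T-A — helper lemmas (one prover cycle each) -/

/-- **H1 (= gen-2 D; UNCONDITIONAL, S ≈ 40 lines).**  `ρ_{E,ℓ}` modular ⇒ every framed model of
`E[ℓ]` is modular (same prime).  Proof plan: ideator-1's PROVED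
`H1_exists_isNewform0_hasGoodReductionAt_cuspCoeff_eq` (descent to `Γ₀(N)` KEEPING the inertia clause:
good reduction off `N ℓ` and `a_p(f₀) = a_p(E)` for `p ∤ N ℓ`) feeds `isModular_of_isNewform0_packet`
(`BCDTModularityTwistProofs`) with `b p := a_p(E)`; the curve side is verbatim the body of
`IsModular.exists_isNewform0_packet` (`hρ.isUnramifiedAt_of_hasGoodReductionAt`,
`hρ.charpoly_eq_of_isArithFrobAt htr hdet`, `htr := trace_galoisRepTate_frobenius_of_hasGoodReductionAt_holds`,
`hdet` from `exists_weilPairing_holds`).  Generalises the tree's `IsModular.isModular_of_isTorsionGaloisRep''`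
(hypothesis `BCDT.IsModular W` weakened to `IsModularGaloisRepTate ℓ`). -/
theorem isModular_torsion_of_isModularGaloisRepTate_self
    (W : WeierstrassCurve ℚ) [W.IsElliptic] (ℓ : ℕ) [Fact ℓ.Prime] (h : W.IsModularGaloisRepTate ℓ)
    {ρ : ModPGaloisRep ℚ (ZMod ℓ) 2} (hρ : W.IsTorsionGaloisRep ℓ ρ) : ρ.IsModular := by
  sorry

/-- **H2 (hole closer in BINDER form; M ≈ 80 lines).**  Given ONE irreducible `ρ_g` attached to the lift
of `f₀` off `N p'` (an instance of `L_A` / `hD` / weak Eichler–Shimura) and `a_p(f₀) = a_p(E)` off a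
finite `T₀`: EVERY `v ∤ N p'` is a place of good reduction with `a_v(f₀) = a_v(E)` — in particular
`v = ℓ'` when `ℓ' ∤ N`.  Proof plan: `exists_framedGaloisRep_rationalTate W p'` (framed `V_{p'}(E)` with
its unramified/charpoly clause at good `v ∌ p'`), ideator-1's PROVED `H2'_equiv_of_isGaloisRepOfNewform1`
(`ρ_g ≅ V_{p'}(E) ⊗ ℚ̄_{p'}`), transport of `IsUnramifiedAt` / `HasFrobCharpolyAt` along the equivalence
and down the base change (`FramedGaloisRep.isUnramifiedAt_baseChange_iff`, `hasFrobCharpolyAt_baseChange`),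
Néron–Ogg–Shafarevich for `V_{p'}` (`hasGoodReductionAt_iff_forall_rationalGaloisRepTate_eq_one`,
`neronOggShafarevich_holds`), then the `X`-coefficient.  Diamond–Shurman Prop. 9.6.4 / Ex. 9.6.2. -/
theorem hasGoodReductionAt_and_cuspCoeff_eq_of_isGaloisRepOfNewform1
    (W : WeierstrassCurve ℚ) [W.IsElliptic] {N : ℕ} [NeZero N] {f₀ : CuspForm (Gamma0 N) 2}
    (hf₀ : IsNewform0 f₀) {T₀ : ℕ} (hT₀ : T₀ ≠ 0)
    (hfp : ∀ p : ℕ, p.Prime → ¬ p ∣ T₀ → cuspCoeff f₀ p = (W.LFunction p : ℂ))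
    (p' : ℕ) [Fact p'.Prime] (ι : PadicAlgCl p' ≃+* ℂ) (ρg : FramedGaloisRep ℚ (PadicAlgCl p') 2)
    (hρg : IsGaloisRepOfNewform1 (liftToGamma1 N 2 f₀)
      ((ι.symm : ℂ →+* PadicAlgCl p').comp (algebraMap (coeffCharField (liftToGamma1 N 2 f₀)) ℂ))
      {q | q ∣ N * p'} ρg)
    (hirr : ρg.toGaloisRep.IsIrreducible)
    (v : HeightOneSpectrum (𝓞 ℚ)) (hv : ¬ ((primesEquiv v : ℕ) ∣ N * p')) :
    W.HasGoodReductionAt v ∧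
      cuspCoeff f₀ (primesEquiv v : ℕ) = (W.LFunction (primesEquiv v : ℕ) : ℂ) := by
  sorry

/-- **H3 (= gen-2 B re-based on `L_A`; S ≈ 60 lines on top of H1's pattern + H2).**  `ρ_{E,ℓ'}` modular
⇒ every framed model of `E[ℓ]` is modular, for EVERY prime `ℓ`.  Proof plan: the rational newform `f₀`
of `exists_rational_isNewform0_of_isModularGaloisRepTate'` (integrality is what `hR` wants;
`a_p(f₀) = a_p(E)` off `T₀ := N ℓ' N_E`); `hR f₀ _ _ (N * ℓ' * ℓ * N_E)` gives `p' > N ℓ' ℓ N_E` and `ρ_g`;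
the packet `b p := a_p(E)` off `N ℓ` for `isModular_of_isNewform0_packet`: at `p = p'` directly from
`hfp` (`p' > T₀ ⇒ p' ∤ T₀`) and good reduction from `p' ∤ N_E` (`dvd_conductorNorm_iff`), at `p ∤ N p'`
from H2; curve side as in H1. -/
theorem isModular_torsion_of_isModularGaloisRepTate (hR : RatNewformGaloisRepCofinal)
    (W : WeierstrassCurve ℚ) [W.IsElliptic] (ℓ' : ℕ) [Fact ℓ'.Prime] (h : W.IsModularGaloisRepTate ℓ')
    (ℓ : ℕ) [Fact ℓ.Prime] {ρ : ModPGaloisRep ℚ (ZMod ℓ) 2} (hρ : W.IsTorsionGaloisRep ℓ ρ) :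
    ρ.IsModular := by
  sorry

/-! ## Glue (kernel-checked) -/

/-- `h32T ⇐ L_A` (`ℓ' = 3`, `ℓ = 5`). -/
theorem sigThreeImpTwoTorsion_of_ratGaloisRep (hR : RatNewformGaloisRepCofinal) :
    SigThreeImpTwoTorsion :=
  fun W _ h _ρ hρ ↦ isModular_torsion_of_isModularGaloisRepTate hR W 3 h 5 hρ

/-- `h32T ⇐ hD` — the SAME named fact any `R = T` proof of `stub_liftThree` / `stub_liftFive` consumes
(Galois representations attached to weight-two eigenforms), so the recut adds no leaf to the line. -/
theorem sigThreeImpTwoTorsion_of_hida (hD : Hida2000_thm326_exists_galoisRep) :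
    SigThreeImpTwoTorsion :=
  sigThreeImpTwoTorsion_of_ratGaloisRep (ratNewformGaloisRepCofinal_of_hida hD)

/-- Sanity: `h32T` is WEAKER than S9. -/
theorem sigThreeImpTwoTorsion_of_stub (h32 : SigStubThreeImpTwo) : SigThreeImpTwoTorsion := by
  intro W _ h ρ hρ
  haveI : NeZero (W.conductorNorm ℤ) := ⟨(conductorNorm_pos_holds W).ne'⟩
  exact (h32 W 3 h).isModular_of_isTorsionGaloisRep'' hρ

/-- Sanity: `h32F` is WEAKER than S9. -/
theorem sigThreeImpTwoFrey_of_stub (h32 : SigStubThreeImpTwo) : SigThreeImpTwoFrey :=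
  fun a b _ _ _ _ ℓ _ h ↦ h32 (freyCurve a b) ℓ h

/-! ## The recut composition (kernel-checked): what a lead registers instead of consuming S9 thrice -/

/-- **Every Frey curve is modular from the RECUT stub set** `{S1a, S1b, S2, h32F, h32T, S3}` (plus the
skeleton's Frey rigidity inputs `h4a`, `h4b`, `h6` and its landed `h9`, `h25`): the proof of the
skeleton's `isModular_freyCurve_of_stubs` (CDT 1999, proof of Thm. 7.1.2, p. 556, run on a Frey curve)
with `liftThree_of_stubs` / `liftFive_of_stubs` inlined and S9 consumed ONLY as `h32F` (on the Frey
curve, at `ℓ = 3` in case A and `ℓ = 5` in case B) and `h32T` (on the switched curve `W'`). -/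
theorem isModular_freyCurve_of_recut
    (hmod3 : ∀ (W : WeierstrassCurve ℚ) [W.IsElliptic] (ρ : ModPGaloisRep ℚ (ZMod 3) 2),
      W.IsTorsionGaloisRep 3 ρ → FramedRep.IsAbsolutelyIrreducible ρ → ρ.IsModular)
    (hlift3 : ∀ (W : WeierstrassCurve ℚ) [W.IsElliptic] (ρ : ModPGaloisRep ℚ (ZMod 3) 2),
      W.IsTorsionGaloisRep 3 ρ → ρ.IsAbsIrreducibleOverSqrt (-3) → ¬ 9 ∣ W.conductorNorm ℤ →
      ρ.IsModular → W.IsModularGaloisRepTate 3)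
    (hlift5 : ∀ (W : WeierstrassCurve ℚ) [W.IsElliptic] (ρ : ModPGaloisRep ℚ (ZMod 5) 2),
      W.IsTorsionGaloisRep 5 ρ → ρ.IsAbsIrreducibleOverSqrt 5 → ¬ 25 ∣ W.conductorNorm ℤ →
      ρ.IsModular → W.IsModularGaloisRepTate 5)
    (h32F : SigThreeImpTwoFrey) (h32T : SigThreeImpTwoTorsion)
    (h3 : ∀ (W : WeierstrassCurve ℚ) [W.IsElliptic], ¬ 27 ∣ W.conductorNorm ℤ →
      (∀ ρ₃ : ModPGaloisRep ℚ (ZMod 3) 2, W.IsTorsionGaloisRep 3 ρ₃ →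
        ¬ ρ₃.IsAbsIrreducibleOverSqrt (-3)) →
      ∀ (ρ : ModPGaloisRep ℚ (ZMod 5) 2), W.IsTorsionGaloisRep 5 ρ → ρ.IsAbsIrreducibleOverSqrt 5 →
      ∃ (W' : WeierstrassCurve ℚ) (_ : W'.IsElliptic), W'.IsTorsionGaloisRep 5 ρ ∧
        ∃ ρ₃' : ModPGaloisRep ℚ (ZMod 3) 2, W'.IsTorsionGaloisRep 3 ρ₃' ∧
          ρ₃'.IsAbsIrreducibleOverSqrt (-3))
    (h4a : ∀ a b : ℤ, IsCoprime a b → a * b * (a + b) ≠ 0 →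
      ∀ ρ : ModPGaloisRep ℚ (ZMod 5) 2, (freyCurve a b).IsTorsionGaloisRep 5 ρ →
        FramedRep.IsIrreducible ρ)
    (h4b : ∀ (W : WeierstrassCurve ℚ) [W.IsElliptic], ¬ 25 ∣ W.conductorNorm ℤ →
      ∀ ρ : ModPGaloisRep ℚ (ZMod 5) 2, W.IsTorsionGaloisRep 5 ρ →
        FramedRep.IsIrreducible ρ → ρ.IsAbsIrreducibleOverSqrt 5)
    (h6 : ∀ (W W' : WeierstrassCurve ℚ) [W.IsElliptic] [W'.IsElliptic]
      (ρ : ModPGaloisRep ℚ (ZMod 5) 2),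
      W.IsTorsionGaloisRep 5 ρ → W'.IsTorsionGaloisRep 5 ρ →
      ¬ 9 ∣ W.conductorNorm ℤ → ¬ 9 ∣ W'.conductorNorm ℤ)
    {a b : ℤ} (hab : IsCoprime a b) (h0 : a * b * (a + b) ≠ 0)
    [NeZero ((freyCurve a b).conductorNorm ℤ)]
    (h9 : ¬ 9 ∣ (freyCurve a b).conductorNorm ℤ) (h25 : ¬ 25 ∣ (freyCurve a b).conductorNorm ℤ) :
    BCDT.IsModular (freyCurve a b) := by
  haveI := isElliptic_freyCurve h0
  -- case A: some framed model of `E[3]` is absolutely irreducible over `ℚ(√-3)`: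
  -- S1a + S1b give `ρ_{E,3}` modular, and `h32F` (S9 on the FREY CURVE, `ℓ = 3`) gives `E` modular
  by_cases hA : ∃ ρ₃ : ModPGaloisRep ℚ (ZMod 3) 2,
      (freyCurve a b).IsTorsionGaloisRep 3 ρ₃ ∧ ρ₃.IsAbsIrreducibleOverSqrt (-3)
  · obtain ⟨ρ₃, hρ₃, h3i⟩ := hA
    exact h32F a b hab h0 3
      (hlift3 (freyCurve a b) ρ₃ hρ₃ h3i h9
        (hmod3 (freyCurve a b) ρ₃ hρ₃ h3i.isAbsolutelyIrreducible))
  -- case B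
  have hB : ∀ ρ₃ : ModPGaloisRep ℚ (ZMod 3) 2, (freyCurve a b).IsTorsionGaloisRep 3 ρ₃ →
      ¬ ρ₃.IsAbsIrreducibleOverSqrt (-3) := fun ρ₃ hρ₃ h3i ↦ hA ⟨ρ₃, hρ₃, h3i⟩
  have h27 : ¬ 27 ∣ (freyCurve a b).conductorNorm ℤ := fun h27 ↦ h9 (dvd_trans ⟨3, rfl⟩ h27)
  obtain ⟨ρ, hρ⟩ := (freyCurve a b).exists_isTorsionGaloisRep 5
  have hirr : FramedRep.IsIrreducible ρ := h4a a b hab h0 ρ hρ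
  have h5 : ρ.IsAbsIrreducibleOverSqrt 5 := h4b (freyCurve a b) h25 ρ hρ hirr
  -- the `3`–`5` switch
  obtain ⟨W', hW', hρ', ρ₃', hρ₃', h3i'⟩ := h3 (freyCurve a b) h27 hB ρ hρ h5
  haveI := hW'
  have h9' : ¬ 9 ∣ W'.conductorNorm ℤ := h6 (freyCurve a b) W' ρ hρ hρ' h9
  -- `ρ_{E',3}` is modular by S1a + S1b on `W'` …
  have h3' : W'.IsModularGaloisRepTate 3 :=
    hlift3 W' ρ₃' hρ₃' h3i' h9' (hmod3 W' ρ₃' hρ₃' h3i'.isAbsolutelyIrreducible)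
  -- … so `ρ̄ = ρ̄_{E,5} = ρ̄_{E',5}` is modular by `h32T` (TORSION level: no `BCDT.IsModular W'`)
  have hρmod : ρ.IsModular := h32T W' h3' ρ hρ'
  -- and `E` is modular by S2 + `h32F` (S9 on the FREY CURVE, `ℓ = 5`)
  exact h32F a b hab h0 5 (hlift5 (freyCurve a b) ρ hρ h5 h25 hρmod)

end Summit.ABC.ABC.Cruxes.FreyModularity.Sketch.StubIdeasThreeImpTwo2G3

end
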